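import Literature.MathematicalPhysics.QuantumLattice.HubbardModel
import Literature.MathematicalPhysics.QuantumLattice.HubbardRectangularTorus
import Literature.MathematicalPhysics.QuantumLattice.HubbardBootstrapCertificate
import Literature.MathematicalPhysics.QuantumLattice.HubbardBootstrapCertificateResidual
import Literature.MathematicalPhysics.QuantumLattice.HeisenbergModel
import Literature.MathematicalPhysics.QuantumLattice.HubbardSpinChargeCertificate
import Literature.MathematicalPhysics.QuantumLattice.SectorGroundState
import Literature.MathematicalPhysics.QuantumLattice.HubbardTorusLocalCertificate
import Literature.MathematicalPhysics.QuantumLattice.HubbardTorus2DEnergyDensity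
import Literature.MathematicalPhysics.QuantumLattice.HubbardWindowCertificateD4
import Literature.MathematicalPhysics.QuantumLattice.HubbardCorrelatorCertificate
import Literature.MathematicalPhysics.QuantumLattice.HubbardCorrelatorCertificateAffine
import Literature.MathematicalPhysics.QuantumLattice.HubbardChainDoubleOccupancyLiebWu
import Literature.MathematicalPhysics.QuantumLattice.HubbardKineticEnergyDensity
import Literature.MathematicalPhysics.QuantumLattice.HeisenbergWindowCertificateSquare
import Literature.MathematicalPhysics.QuantumLattice.HubbardTorusLimitSpinCorrelationSign
import Literature.MathematicalPhysics.QuantumLattice.HubbardTorusChargeGapSpinGap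
import Literature.MathematicalPhysics.QuantumLattice.HubbardSzSectorMonotone
import Literature.MathematicalPhysics.QuantumLattice.HubbardHalfFilledSectorOrdering
import Literature.MathematicalPhysics.QuantumLattice.HubbardRingPerronFrobeniusProofs
import Literature.MathematicalPhysics.QuantumLattice.HubbardSectorCorrelatorCertificate
import Literature.MathematicalPhysics.QuantumLattice.HubbardOddSectorReduction
import Summits.HubbardSuperconductivity.HubbardLadder.HubbardMomentRows
import Summits.HubbardSuperconductivity.HubbardLadder.Bounds.TorusRayleighUpperRows
import HarnessLib
import HarnessLib.Audit
import Summits.HubbardSuperconductivity.ManyBodyBootstrap.Bounds.Defs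
import Summits.HubbardSuperconductivity.ManyBodyBootstrap.Bounds.EDTorusRows
import Summits.HubbardSuperconductivity.ManyBodyBootstrap.Bounds.SdpRows1
import Summits.HubbardSuperconductivity.ManyBodyBootstrap.Bounds.SdpRows2
import Summits.HubbardSuperconductivity.ManyBodyBootstrap.Bounds.SdpRows3
import Summits.HubbardSuperconductivity.ManyBodyBootstrap.Bounds.SdpRows4
import Summits.HubbardSuperconductivity.ManyBodyBootstrap.Bounds.SdpRows5
import Summits.HubbardSuperconductivity.ManyBodyBootstrap.Bounds.Corollaries1
import Summits.HubbardSuperconductivity.ManyBodyBootstrap.Bounds.Corollaries2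
import Summits.HubbardSuperconductivity.ManyBodyBootstrap.Bounds.Corollaries3
import Summits.HubbardSuperconductivity.ManyBodyBootstrap.Bounds.Corollaries4
import Summits.HubbardSuperconductivity.ManyBodyBootstrap.Bounds.Corollaries5
import Summits.HubbardSuperconductivity.ManyBodyBootstrap.Bounds.Corollaries6
import Summits.HubbardSuperconductivity.ManyBodyBootstrap.Bounds.OneHoleUpperRows
import Summits.HubbardSuperconductivity.ManyBodyBootstrap.Bounds.SdpRows6
import Summits.HubbardSuperconductivity.ManyBodyBootstrap.Bounds.Corollaries7
import Summits.HubbardSuperconductivity.ManyBodyBootstrap.Bounds.Defs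
import Summits.HubbardSuperconductivity.ManyBodyBootstrap.Bounds.SdpRows7

/-!
# Many-body bootstrap — Bounds: kernel-checked corollaries (new trailer; see section banners)

Part `Corollaries8` (2/2) of the cell's staged module `HubbardCertifiedBoundsNext.lean` (sha256 `c7d41436578f7f36…`), filed under the
cell topic `ManyBodyBootstrap` (lit seat pub-mbboot, tool `file_parts_g19.py`; unit→part table in HOME/PLACEMENT.md).
Declarations are the staged ones, byte-identical up to: namespace `Summit.HubbardSuperconductivity.Bounds` → `Summit.HubbardSuperconductivity.ManyBodyBootstrap.Bounds`,
`@[conjecture]` on every certificate CLAIM NODE (`def … : Prop`, an open obligation node closable in-kernel from the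
certificate's exact data — NOT a vendored fact) and a closing `[computation: <format>, exact ℚ]` tag in its docstring.
Scope, provenance, certificate formats, verifiers and the PROVED soundness theorems are stated in the module docstring of
part `Defs` and in each row's docstring. HONEST FRAMING: certified numerical bounds on a lattice model; not
superconductivity, not a phase diagram.
-/

noncomputable section

namespace Summit.HubbardSuperconductivity.ManyBodyBootstrap.Bounds

open Literature.MathematicalPhysics.QuantumLattice
open Summit.HubbardSuperconductivity.HubbardLadder (stagStructureFour)
open Summit.HubbardSuperconductivity.HubbardLadder (localMomentFour re_expect_localMomentFour)
open Summit.HubbardSuperconductivity.HubbardLadder.Bounds (torusUpper_mbbootE2_4x4_U8_N16 groundEnergyAt_rect_4x4_U8_N16_le_of_claim torusUpper_mbbootE2_4x4_U4_N16 groundEnergyAt_rect_4x4_U4_N16_le_of_claim)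
open Summit.HubbardSuperconductivity.HubbardLadder.Bounds (torusUpper_mbbootE2_4x4_U2_N16 groundEnergyAt_rect_4x4_U2_N16_le_of_claim torusUpper_mbbootE2_4x4_U12_N16 groundEnergyAt_rect_4x4_U12_N16_le_of_claim)
open Summit.HubbardSuperconductivity.HubbardLadder.Bounds (torusUpper_mbbootE2_4x4_U6_N16 groundEnergyAt_rect_4x4_U6_N16_le_of_claim)
open Literature.Probability.LatticeModels
open Filter Topology HubbardWave0 Literature.MathematicalPhysics.QuantumManyBody.StateRelaxation
open scoped Matrix

/-! ## part Corollaries8 -/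
/-! ## gen-128: sector-correlator corollaries of the half-filled `4×4` torus at `U = 2, 6, 12` (E-7 tranche)
Rows `sdp_corr_sector_hub_torus4x4_U{2,6,12}_N16_b4eom_*` (certsdp 0.4.3, kit j098934–j098958; index rows 139–150; GENERATED by
pub-mbboot-typer/g128/mk_trailer_g128.py from certs/sdp1/index.json, exact ℚ computed in-script, decimals rounded OUTWARD).
Every theorem assumes the rows' hypothesis `E₀(16) ≤ u` with `u` = E2's certified Rayleigh upper (tree claim node
`torusUpper_mbbootE2_4x4_U<U>_N16`), exactly as trailer_g124/g125 did at `U = 4, 8`. Zero admits. -/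

section Gen128SectorCorrelatorsU2U6U12

/-- **Two-sided bracket on the double occupancy of the `4×4`, `U = 2`, half-filled ground state** from the rows
`sdp_corr_sector_hub_torus4x4_U2_N16_b4eom_D{lo,up}` (kit j098942, j098943) only: for every unit `16`-particle ground vector `ψ` of
`hamiltonian (fermionTorusGraph 2 4) 1 2`, given the rows' hypothesis `E₀(16) ≤ u = -19810528947877/1099511627776` (E2's certified Rayleigh upper,
stated on `E₀ 4 4 1 2 16`; transferred by `groundEnergyAt_fermionTorusGraph_two`), `N_D = ⟨Σ_x n_{x↑}n_{x↓}⟩ ∈ [2.3976809, 2.6847556]`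
(exact `[2898618462827558283684323/1208925819614629174706176, 3245670278078222891062403/1208925819614629174706176]`) and `d = N_D/16 ∈ [0.149855, 0.1677973]` (decimals rounded outward; `expect A ψ = ⟨ψ, Aψ⟩`). Zero admits. -/
theorem doubleOcc_4x4_U2_bracket
    (lo : sdp_corr_sector_hub_torus4x4_U2_N16_b4eom_Dlo) (up : sdp_corr_sector_hub_torus4x4_U2_N16_b4eom_Dup)
    (hu : E₀ 4 4 1 2 16 ≤ -19810528947877/1099511627776)
    {ψ : Fock (Orb (FermionTorus 2 4))} (hψ : IsGroundState (hamiltonian (fermionTorusGraph 2 4) 1 2) 16 ψ)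
    (hψ1 : star ψ ⬝ᵥ ψ = 1) :
    (2.3976809 : ℝ) ≤ (expect (∑ x : FermionTorus 2 4, numberOp x 0 * numberOp x 1) ψ).re ∧
    (expect (∑ x : FermionTorus 2 4, numberOp x 0 * numberOp x 1) ψ).re ≤ 2.6847556 ∧
    (0.149855 : ℝ) ≤ (expect (∑ x : FermionTorus 2 4, numberOp x 0 * numberOp x 1) ψ).re / 16 ∧
    (expect (∑ x : FermionTorus 2 4, numberOp x 0 * numberOp x 1) ψ).re / 16 ≤ 0.1677973 := by
  have hu' : groundEnergyAt (fermionTorusGraph 2 4) 1 2 16 ≤ ((-19810528947877/1099511627776 : ℚ) : ℝ) := by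
    rw [groundEnergyAt_fermionTorusGraph_two]; push_cast; simpa [E₀] using hu
  have hH : hamiltonian (fermionTorusGraph 2 4) 1 2 *ᵥ ψ =
      ((groundEnergyAt (fermionTorusGraph 2 4) 1 2 16 : ℝ) : ℂ) • ψ := hψ.2.2
  have h1 := lo hu' ψ hψ.1 hψ1 hH
  have h2 := up hu' ψ hψ.1 hψ1 hH
  rw [Matrix.smul_mulVec, dotProduct_smul] at h1 h2
  push_cast at h1 h2
  simp only [one_smul, neg_smul, Complex.neg_re] at h1 h2
  unfold expect
  refine ⟨?_, ?_, ?_, ?_⟩ <;> linarith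

/-- **Local moment of the `4×4`, `U = 2`, half-filled ground state**: `m_loc = ⟨M⟩/16 = 1 − 2d ∈ [0.6644055, 0.7002899]`
(`M = localMomentFour`; kernel identity `re_expect_localMomentFour`, HubbardMomentRows.lean), from `doubleOcc_4x4_U2_bracket`.
Comparison: pub-hubbard's exact-hypothesis row `localMoment_four_U2_mem_Icc_exact` gives `[0.6260, 0.7514]`. Zero admits. -/
theorem localMoment_4x4_U2_bracket
    (lo : sdp_corr_sector_hub_torus4x4_U2_N16_b4eom_Dlo) (up : sdp_corr_sector_hub_torus4x4_U2_N16_b4eom_Dup)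
    (hu : E₀ 4 4 1 2 16 ≤ -19810528947877/1099511627776)
    {ψ : Fock (Orb (FermionTorus 2 4))} (hψ : IsGroundState (hamiltonian (fermionTorusGraph 2 4) 1 2) 16 ψ)
    (hψ1 : star ψ ⬝ᵥ ψ = 1) :
    (0.6644055 : ℝ) ≤ (expect localMomentFour ψ).re / 16 ∧ (expect localMomentFour ψ).re / 16 ≤ 0.7002899 := by
  obtain ⟨h1, h2, -, -⟩ := doubleOcc_4x4_U2_bracket lo up hu hψ hψ1
  rw [re_expect_localMomentFour hψ.1 hψ1]
  push_cast
  constructor <;> linarith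

/-- `doubleOcc_4x4_U2_bracket` (per-site part) with the hypothesis taken as the claim node `torusUpper_mbbootE2_4x4_U2_N16`. Zero admits. -/
theorem doubleOcc_4x4_U2_bracket_of_claim
    (lo : sdp_corr_sector_hub_torus4x4_U2_N16_b4eom_Dlo) (up : sdp_corr_sector_hub_torus4x4_U2_N16_b4eom_Dup)
    (h : torusUpper_mbbootE2_4x4_U2_N16)
    {ψ : Fock (Orb (FermionTorus 2 4))} (hψ : IsGroundState (hamiltonian (fermionTorusGraph 2 4) 1 2) 16 ψ)
    (hψ1 : star ψ ⬝ᵥ ψ = 1) :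
    (0.149855 : ℝ) ≤ (expect (∑ x : FermionTorus 2 4, numberOp x 0 * numberOp x 1) ψ).re / 16 ∧
    (expect (∑ x : FermionTorus 2 4, numberOp x 0 * numberOp x 1) ψ).re / 16 ≤ 0.1677973 :=
  (doubleOcc_4x4_U2_bracket lo up
  (by have := groundEnergyAt_rect_4x4_U2_N16_le_of_claim h; unfold E₀; push_cast; linarith) hψ hψ1).2.2

/-- **Two-sided bracket on the nearest-neighbour spin correlation of the `4×4`, `U = 2`, half-filled ground state** from the rows
`sdp_corr_sector_hub_torus4x4_U2_N16_b4eom_S{lo,up}` (kit j098944, j098946) only: for every unit `16`-particle ground vector `ψ` of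
`hamiltonian (fermionTorusGraph 2 4) 1 2`, given `E₀(16) ≤ u = -19810528947877/1099511627776` (E2's certified Rayleigh upper), the ORDERED-adjacent-pair operator
`𝓑 = Σ_{x ~ y} 𝐒_x·𝐒_y` (64 ordered pairs = `2·Σ_bonds`, `fermionSpinDot_comm`) has `⟨𝓑⟩ ∈ [-11.6428472, -4.7915081]` (exact `[-7037669294430231031479435/604462909807314587353088, -1448144485765596058816921/302231454903657293676544]`),
i.e. the per-bond correlation `C₁ = ⟨𝓑⟩/64 ∈ [-0.1819195, -0.0748673]` (decimals rounded outward); in particular `C₁ < 0` (antiferromagnetic on average). Zero admits. -/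
theorem spinNN_4x4_U2_bracket
    (lo : sdp_corr_sector_hub_torus4x4_U2_N16_b4eom_Slo) (up : sdp_corr_sector_hub_torus4x4_U2_N16_b4eom_Sup)
    (hu : E₀ 4 4 1 2 16 ≤ -19810528947877/1099511627776)
    {ψ : Fock (Orb (FermionTorus 2 4))} (hψ : IsGroundState (hamiltonian (fermionTorusGraph 2 4) 1 2) 16 ψ)
    (hψ1 : star ψ ⬝ᵥ ψ = 1) :
    (-11.6428472 : ℝ) ≤ (expect (∑ x : FermionTorus 2 4, ∑ y : FermionTorus 2 4, if (fermionTorusGraph 2 4).Adj x y then fermionSpinDot x y else 0) ψ).re ∧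
    (expect (∑ x : FermionTorus 2 4, ∑ y : FermionTorus 2 4, if (fermionTorusGraph 2 4).Adj x y then fermionSpinDot x y else 0) ψ).re ≤ -4.7915081 ∧
    (-0.1819195 : ℝ) ≤ (expect (∑ x : FermionTorus 2 4, ∑ y : FermionTorus 2 4, if (fermionTorusGraph 2 4).Adj x y then fermionSpinDot x y else 0) ψ).re / 64 ∧
    (expect (∑ x : FermionTorus 2 4, ∑ y : FermionTorus 2 4, if (fermionTorusGraph 2 4).Adj x y then fermionSpinDot x y else 0) ψ).re / 64 ≤ -0.0748673 := by
  have hu' : groundEnergyAt (fermionTorusGraph 2 4) 1 2 16 ≤ ((-19810528947877/1099511627776 : ℚ) : ℝ) := by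
    rw [groundEnergyAt_fermionTorusGraph_two]; push_cast; simpa [E₀] using hu
  have hH : hamiltonian (fermionTorusGraph 2 4) 1 2 *ᵥ ψ =
      ((groundEnergyAt (fermionTorusGraph 2 4) 1 2 16 : ℝ) : ℂ) • ψ := hψ.2.2
  have h1 := lo hu' ψ hψ.1 hψ1 hH
  have h2 := up hu' ψ hψ.1 hψ1 hH
  rw [Matrix.smul_mulVec, dotProduct_smul] at h1 h2
  push_cast at h1 h2
  simp only [one_smul, neg_smul, Complex.neg_re] at h1 h2
  unfold expect
  refine ⟨?_, ?_, ?_, ?_⟩ <;> linarith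

/-- `spinNN_4x4_U2_bracket` (per-bond part) with the hypothesis taken as the claim node `torusUpper_mbbootE2_4x4_U2_N16`. Zero admits. -/
theorem spinNN_4x4_U2_bracket_of_claim
    (lo : sdp_corr_sector_hub_torus4x4_U2_N16_b4eom_Slo) (up : sdp_corr_sector_hub_torus4x4_U2_N16_b4eom_Sup)
    (h : torusUpper_mbbootE2_4x4_U2_N16)
    {ψ : Fock (Orb (FermionTorus 2 4))} (hψ : IsGroundState (hamiltonian (fermionTorusGraph 2 4) 1 2) 16 ψ)
    (hψ1 : star ψ ⬝ᵥ ψ = 1) :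
    (-0.1819195 : ℝ) ≤ (expect (∑ x : FermionTorus 2 4, ∑ y : FermionTorus 2 4, if (fermionTorusGraph 2 4).Adj x y then fermionSpinDot x y else 0) ψ).re / 64 ∧
    (expect (∑ x : FermionTorus 2 4, ∑ y : FermionTorus 2 4, if (fermionTorusGraph 2 4).Adj x y then fermionSpinDot x y else 0) ψ).re / 64 ≤ -0.0748673 :=
  (spinNN_4x4_U2_bracket lo up
  (by have := groundEnergyAt_rect_4x4_U2_N16_le_of_claim h; unfold E₀; push_cast; linarith) hψ hψ1).2.2

/-- **Two-sided bracket on the staggered spin structure of the `4×4`, `U = 2`, half-filled ground state** from the rows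
`sdp_corr_sector_hub_torus4x4_U2_N16_b4eom_AF{lo,up}` (kit j098948, j098950) only: for every unit `16`-particle ground vector `ψ` of
`hamiltonian (fermionTorusGraph 2 4) 1 2`, given `E₀(16) ≤ u = -19810528947877/1099511627776` (E2's certified Rayleigh upper), the per-site staggered structure factor
`S(π,π) = ⟨𝓢⟩/16 ∈ [0.7266756, 2.2897438]` and `m_s² = ⟨𝓢⟩/256 ∈ [0.0454172, 0.143109]` (exact `[14055950634104555426200137/1208925819614629174706176/16, 44290085109040257778969007/1208925819614629174706176/16]`; decimals rounded outward;
`𝓢 = stagStructureFour`). Comparison: pub-hubbard's `stagMagSq_four_U2_mem_Icc_of_bounds_exact` gives `m_s² ∈ [0.0586, 0.2349]`. Zero admits. -/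
theorem stagStructure_4x4_U2_bracket
    (lo : sdp_corr_sector_hub_torus4x4_U2_N16_b4eom_AFlo) (up : sdp_corr_sector_hub_torus4x4_U2_N16_b4eom_AFup)
    (hu : E₀ 4 4 1 2 16 ≤ -19810528947877/1099511627776)
    {ψ : Fock (Orb (FermionTorus 2 4))} (hψ : IsGroundState (hamiltonian (fermionTorusGraph 2 4) 1 2) 16 ψ)
    (hψ1 : star ψ ⬝ᵥ ψ = 1) :
    (0.7266756 : ℝ) ≤ (expect stagStructureFour ψ).re / 16 ∧ (expect stagStructureFour ψ).re / 16 ≤ 2.2897438 ∧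
    (0.0454172 : ℝ) ≤ (expect stagStructureFour ψ).re / 256 ∧ (expect stagStructureFour ψ).re / 256 ≤ 0.143109 := by
  have hu' : groundEnergyAt (fermionTorusGraph 2 4) 1 2 16 ≤ ((-19810528947877/1099511627776 : ℚ) : ℝ) := by
    rw [groundEnergyAt_fermionTorusGraph_two]; push_cast; simpa [E₀] using hu
  have hH : hamiltonian (fermionTorusGraph 2 4) 1 2 *ᵥ ψ =
      ((groundEnergyAt (fermionTorusGraph 2 4) 1 2 16 : ℝ) : ℂ) • ψ := hψ.2.2
  have h1 := lo hu' ψ hψ.1 hψ1 hH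
  have h2 := up hu' ψ hψ.1 hψ1 hH
  rw [Matrix.smul_mulVec, dotProduct_smul] at h1 h2
  push_cast at h1 h2
  simp only [one_smul, neg_smul, Complex.neg_re] at h1 h2
  unfold expect
  refine ⟨?_, ?_, ?_, ?_⟩ <;> linarith

/-- `stagStructure_4x4_U2_bracket` with the hypothesis taken as the claim node `torusUpper_mbbootE2_4x4_U2_N16`. Zero admits. -/
theorem stagStructure_4x4_U2_bracket_of_claim
    (lo : sdp_corr_sector_hub_torus4x4_U2_N16_b4eom_AFlo) (up : sdp_corr_sector_hub_torus4x4_U2_N16_b4eom_AFup)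
    (h : torusUpper_mbbootE2_4x4_U2_N16)
    {ψ : Fock (Orb (FermionTorus 2 4))} (hψ : IsGroundState (hamiltonian (fermionTorusGraph 2 4) 1 2) 16 ψ)
    (hψ1 : star ψ ⬝ᵥ ψ = 1) :
    (0.7266756 : ℝ) ≤ (expect stagStructureFour ψ).re / 16 ∧ (expect stagStructureFour ψ).re / 16 ≤ 2.2897438 ∧
    (0.0454172 : ℝ) ≤ (expect stagStructureFour ψ).re / 256 ∧ (expect stagStructureFour ψ).re / 256 ≤ 0.143109 :=
  stagStructure_4x4_U2_bracket lo up
  (by have := groundEnergyAt_rect_4x4_U2_N16_le_of_claim h; unfold E₀; push_cast; linarith) hψ hψ1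

/-- **Two-sided bracket on the double occupancy of the `4×4`, `U = 6`, half-filled ground state** from the rows
`sdp_corr_sector_hub_torus4x4_U6_N16_b4eom_D{lo,up}` (kit j098934, j098935) only: for every unit `16`-particle ground vector `ψ` of
`hamiltonian (fermionTorusGraph 2 4) 1 6`, given the rows' hypothesis `E₀(16) ≤ u = -725141255523/68719476736` (E2's certified Rayleigh upper,
stated on `E₀ 4 4 1 6 16`; transferred by `groundEnergyAt_fermionTorusGraph_two`), `N_D = ⟨Σ_x n_{x↑}n_{x↓}⟩ ∈ [1.0864084, 1.6027397]`
(exact `[1313387181036786025428489/1208925819614629174706176, 1937593316028244337767695/1208925819614629174706176]`) and `d = N_D/16 ∈ [0.0679005, 0.1001713]` (decimals rounded outward; `expect A ψ = ⟨ψ, Aψ⟩`). Zero admits. -/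
theorem doubleOcc_4x4_U6_bracket
    (lo : sdp_corr_sector_hub_torus4x4_U6_N16_b4eom_Dlo) (up : sdp_corr_sector_hub_torus4x4_U6_N16_b4eom_Dup)
    (hu : E₀ 4 4 1 6 16 ≤ -725141255523/68719476736)
    {ψ : Fock (Orb (FermionTorus 2 4))} (hψ : IsGroundState (hamiltonian (fermionTorusGraph 2 4) 1 6) 16 ψ)
    (hψ1 : star ψ ⬝ᵥ ψ = 1) :
    (1.0864084 : ℝ) ≤ (expect (∑ x : FermionTorus 2 4, numberOp x 0 * numberOp x 1) ψ).re ∧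
    (expect (∑ x : FermionTorus 2 4, numberOp x 0 * numberOp x 1) ψ).re ≤ 1.6027397 ∧
    (0.0679005 : ℝ) ≤ (expect (∑ x : FermionTorus 2 4, numberOp x 0 * numberOp x 1) ψ).re / 16 ∧
    (expect (∑ x : FermionTorus 2 4, numberOp x 0 * numberOp x 1) ψ).re / 16 ≤ 0.1001713 := by
  have hu' : groundEnergyAt (fermionTorusGraph 2 4) 1 6 16 ≤ ((-725141255523/68719476736 : ℚ) : ℝ) := by
    rw [groundEnergyAt_fermionTorusGraph_two]; push_cast; simpa [E₀] using hu
  have hH : hamiltonian (fermionTorusGraph 2 4) 1 6 *ᵥ ψ =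
      ((groundEnergyAt (fermionTorusGraph 2 4) 1 6 16 : ℝ) : ℂ) • ψ := hψ.2.2
  have h1 := lo hu' ψ hψ.1 hψ1 hH
  have h2 := up hu' ψ hψ.1 hψ1 hH
  rw [Matrix.smul_mulVec, dotProduct_smul] at h1 h2
  push_cast at h1 h2
  simp only [one_smul, neg_smul, Complex.neg_re] at h1 h2
  unfold expect
  refine ⟨?_, ?_, ?_, ?_⟩ <;> linarith

/-- **Local moment of the `4×4`, `U = 6`, half-filled ground state**: `m_loc = ⟨M⟩/16 = 1 − 2d ∈ [0.7996575, 0.864199]`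
(`M = localMomentFour`; kernel identity `re_expect_localMomentFour`, HubbardMomentRows.lean), from `doubleOcc_4x4_U6_bracket`.
Comparison: pub-hubbard's exact-hypothesis row `localMoment_four_U6_mem_Icc_exact` gives `[0.7820, 0.9056]`. Zero admits. -/
theorem localMoment_4x4_U6_bracket
    (lo : sdp_corr_sector_hub_torus4x4_U6_N16_b4eom_Dlo) (up : sdp_corr_sector_hub_torus4x4_U6_N16_b4eom_Dup)
    (hu : E₀ 4 4 1 6 16 ≤ -725141255523/68719476736)
    {ψ : Fock (Orb (FermionTorus 2 4))} (hψ : IsGroundState (hamiltonian (fermionTorusGraph 2 4) 1 6) 16 ψ)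
    (hψ1 : star ψ ⬝ᵥ ψ = 1) :
    (0.7996575 : ℝ) ≤ (expect localMomentFour ψ).re / 16 ∧ (expect localMomentFour ψ).re / 16 ≤ 0.864199 := by
  obtain ⟨h1, h2, -, -⟩ := doubleOcc_4x4_U6_bracket lo up hu hψ hψ1
  rw [re_expect_localMomentFour hψ.1 hψ1]
  push_cast
  constructor <;> linarith

/-- `doubleOcc_4x4_U6_bracket` (per-site part) with the hypothesis taken as the claim node `torusUpper_mbbootE2_4x4_U6_N16`. Zero admits. -/
theorem doubleOcc_4x4_U6_bracket_of_claim
    (lo : sdp_corr_sector_hub_torus4x4_U6_N16_b4eom_Dlo) (up : sdp_corr_sector_hub_torus4x4_U6_N16_b4eom_Dup)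
    (h : torusUpper_mbbootE2_4x4_U6_N16)
    {ψ : Fock (Orb (FermionTorus 2 4))} (hψ : IsGroundState (hamiltonian (fermionTorusGraph 2 4) 1 6) 16 ψ)
    (hψ1 : star ψ ⬝ᵥ ψ = 1) :
    (0.0679005 : ℝ) ≤ (expect (∑ x : FermionTorus 2 4, numberOp x 0 * numberOp x 1) ψ).re / 16 ∧
    (expect (∑ x : FermionTorus 2 4, numberOp x 0 * numberOp x 1) ψ).re / 16 ≤ 0.1001713 :=
  (doubleOcc_4x4_U6_bracket lo up
  (by have := groundEnergyAt_rect_4x4_U6_N16_le_of_claim h; unfold E₀; push_cast; linarith) hψ hψ1).2.2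

/-- **Ceiling on the nearest-neighbour spin correlation of the `4×4`, `U = 6`, half-filled ground state** from the single row
`sdp_corr_sector_hub_torus4x4_U6_N16_b4eom_Sup` (kit j098937; no `Slo` row in this tranche): for every unit `16`-particle ground vector `ψ` of
`hamiltonian (fermionTorusGraph 2 4) 1 6`, given `E₀(16) ≤ u = -725141255523/68719476736` (E2's certified Rayleigh upper), the ORDERED-adjacent-pair operator
`𝓑 = Σ_{x ~ y} 𝐒_x·𝐒_y` (64 ordered pairs = `2·Σ_bonds`) has `⟨𝓑⟩ ≤ -8.515392` (exact `-2573619339216274664249189/302231454903657293676544`), i.e. the per-bond correlation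
`C₁ = ⟨𝓑⟩/64 ≤ -0.133053` (rounded outward) — certified antiferromagnetic sign on average. Zero admits. -/
theorem spinNN_4x4_U6_ceiling
    (up : sdp_corr_sector_hub_torus4x4_U6_N16_b4eom_Sup)
    (hu : E₀ 4 4 1 6 16 ≤ -725141255523/68719476736)
    {ψ : Fock (Orb (FermionTorus 2 4))} (hψ : IsGroundState (hamiltonian (fermionTorusGraph 2 4) 1 6) 16 ψ)
    (hψ1 : star ψ ⬝ᵥ ψ = 1) :
    (expect (∑ x : FermionTorus 2 4, ∑ y : FermionTorus 2 4, if (fermionTorusGraph 2 4).Adj x y then fermionSpinDot x y else 0) ψ).re ≤ -8.515392 ∧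
    (expect (∑ x : FermionTorus 2 4, ∑ y : FermionTorus 2 4, if (fermionTorusGraph 2 4).Adj x y then fermionSpinDot x y else 0) ψ).re / 64 ≤ -0.133053 := by
  have hu' : groundEnergyAt (fermionTorusGraph 2 4) 1 6 16 ≤ ((-725141255523/68719476736 : ℚ) : ℝ) := by
    rw [groundEnergyAt_fermionTorusGraph_two]; push_cast; simpa [E₀] using hu
  have hH : hamiltonian (fermionTorusGraph 2 4) 1 6 *ᵥ ψ =
      ((groundEnergyAt (fermionTorusGraph 2 4) 1 6 16 : ℝ) : ℂ) • ψ := hψ.2.2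
  have h2 := up hu' ψ hψ.1 hψ1 hH
  rw [Matrix.smul_mulVec, dotProduct_smul] at h2
  push_cast at h2
  simp only [one_smul, neg_smul, Complex.neg_re] at h2
  unfold expect
  constructor <;> linarith

/-- `spinNN_4x4_U6_ceiling` (per-bond part) with the hypothesis taken as the claim node `torusUpper_mbbootE2_4x4_U6_N16`. Zero admits. -/
theorem spinNN_4x4_U6_ceiling_of_claim
    (up : sdp_corr_sector_hub_torus4x4_U6_N16_b4eom_Sup)
    (h : torusUpper_mbbootE2_4x4_U6_N16)
    {ψ : Fock (Orb (FermionTorus 2 4))} (hψ : IsGroundState (hamiltonian (fermionTorusGraph 2 4) 1 6) 16 ψ)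
    (hψ1 : star ψ ⬝ᵥ ψ = 1) :
    (expect (∑ x : FermionTorus 2 4, ∑ y : FermionTorus 2 4, if (fermionTorusGraph 2 4).Adj x y then fermionSpinDot x y else 0) ψ).re / 64 ≤ -0.133053 :=
  (spinNN_4x4_U6_ceiling up
  (by have := groundEnergyAt_rect_4x4_U6_N16_le_of_claim h; unfold E₀; push_cast; linarith) hψ hψ1).2

/-- **Two-sided bracket on the staggered spin structure of the `4×4`, `U = 6`, half-filled ground state** from the rows
`sdp_corr_sector_hub_torus4x4_U6_N16_b4eom_AF{lo,up}` (kit j098939, j098940) only: for every unit `16`-particle ground vector `ψ` of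
`hamiltonian (fermionTorusGraph 2 4) 1 6`, given `E₀(16) ≤ u = -725141255523/68719476736` (E2's certified Rayleigh upper), the per-site staggered structure factor
`S(π,π) = ⟨𝓢⟩/16 ∈ [0.7963064, 3.7527506]` and `m_s² = ⟨𝓢⟩/256 ∈ [0.0497691, 0.234547]` (exact `[7701403375270617157884075/604462909807314587353088/16, 72588753289659654948027773/1208925819614629174706176/16]`; decimals rounded outward;
`𝓢 = stagStructureFour`). Comparison: pub-hubbard's `stagMagSq_four_U6_mem_Icc_of_bounds_exact` gives `m_s² ∈ [0.0733, 0.2830]`. Zero admits. -/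
theorem stagStructure_4x4_U6_bracket
    (lo : sdp_corr_sector_hub_torus4x4_U6_N16_b4eom_AFlo) (up : sdp_corr_sector_hub_torus4x4_U6_N16_b4eom_AFup)
    (hu : E₀ 4 4 1 6 16 ≤ -725141255523/68719476736)
    {ψ : Fock (Orb (FermionTorus 2 4))} (hψ : IsGroundState (hamiltonian (fermionTorusGraph 2 4) 1 6) 16 ψ)
    (hψ1 : star ψ ⬝ᵥ ψ = 1) :
    (0.7963064 : ℝ) ≤ (expect stagStructureFour ψ).re / 16 ∧ (expect stagStructureFour ψ).re / 16 ≤ 3.7527506 ∧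
    (0.0497691 : ℝ) ≤ (expect stagStructureFour ψ).re / 256 ∧ (expect stagStructureFour ψ).re / 256 ≤ 0.234547 := by
  have hu' : groundEnergyAt (fermionTorusGraph 2 4) 1 6 16 ≤ ((-725141255523/68719476736 : ℚ) : ℝ) := by
    rw [groundEnergyAt_fermionTorusGraph_two]; push_cast; simpa [E₀] using hu
  have hH : hamiltonian (fermionTorusGraph 2 4) 1 6 *ᵥ ψ =
      ((groundEnergyAt (fermionTorusGraph 2 4) 1 6 16 : ℝ) : ℂ) • ψ := hψ.2.2
  have h1 := lo hu' ψ hψ.1 hψ1 hH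
  have h2 := up hu' ψ hψ.1 hψ1 hH
  rw [Matrix.smul_mulVec, dotProduct_smul] at h1 h2
  push_cast at h1 h2
  simp only [one_smul, neg_smul, Complex.neg_re] at h1 h2
  unfold expect
  refine ⟨?_, ?_, ?_, ?_⟩ <;> linarith

/-- `stagStructure_4x4_U6_bracket` with the hypothesis taken as the claim node `torusUpper_mbbootE2_4x4_U6_N16`. Zero admits. -/
theorem stagStructure_4x4_U6_bracket_of_claim
    (lo : sdp_corr_sector_hub_torus4x4_U6_N16_b4eom_AFlo) (up : sdp_corr_sector_hub_torus4x4_U6_N16_b4eom_AFup)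
    (h : torusUpper_mbbootE2_4x4_U6_N16)
    {ψ : Fock (Orb (FermionTorus 2 4))} (hψ : IsGroundState (hamiltonian (fermionTorusGraph 2 4) 1 6) 16 ψ)
    (hψ1 : star ψ ⬝ᵥ ψ = 1) :
    (0.7963064 : ℝ) ≤ (expect stagStructureFour ψ).re / 16 ∧ (expect stagStructureFour ψ).re / 16 ≤ 3.7527506 ∧
    (0.0497691 : ℝ) ≤ (expect stagStructureFour ψ).re / 256 ∧ (expect stagStructureFour ψ).re / 256 ≤ 0.234547 :=
  stagStructure_4x4_U6_bracket lo up
  (by have := groundEnergyAt_rect_4x4_U6_N16_le_of_claim h; unfold E₀; push_cast; linarith) hψ hψ1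

/-- **Ceiling on the nearest-neighbour spin correlation of the `4×4`, `U = 12`, half-filled ground state** from the single row
`sdp_corr_sector_hub_torus4x4_U12_N16_b4eom_Sup` (kit j098958; no `Slo` row in this tranche): for every unit `16`-particle ground vector `ψ` of
`hamiltonian (fermionTorusGraph 2 4) 1 12`, given `E₀(16) ≤ u = -205889822849/34359738368` (E2's certified Rayleigh upper), the ORDERED-adjacent-pair operator
`𝓑 = Σ_{x ~ y} 𝐒_x·𝐒_y` (64 ordered pairs = `2·Σ_bonds`) has `⟨𝓑⟩ ≤ -14.8539439` (exact `-2244664540679434043077599/151115727451828646838272`), i.e. the per-bond correlation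
`C₁ = ⟨𝓑⟩/64 ≤ -0.2320928` (rounded outward) — certified antiferromagnetic sign on average. Zero admits. -/
theorem spinNN_4x4_U12_ceiling
    (up : sdp_corr_sector_hub_torus4x4_U12_N16_b4eom_Sup)
    (hu : E₀ 4 4 1 12 16 ≤ -205889822849/34359738368)
    {ψ : Fock (Orb (FermionTorus 2 4))} (hψ : IsGroundState (hamiltonian (fermionTorusGraph 2 4) 1 12) 16 ψ)
    (hψ1 : star ψ ⬝ᵥ ψ = 1) :
    (expect (∑ x : FermionTorus 2 4, ∑ y : FermionTorus 2 4, if (fermionTorusGraph 2 4).Adj x y then fermionSpinDot x y else 0) ψ).re ≤ -14.8539439 ∧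
    (expect (∑ x : FermionTorus 2 4, ∑ y : FermionTorus 2 4, if (fermionTorusGraph 2 4).Adj x y then fermionSpinDot x y else 0) ψ).re / 64 ≤ -0.2320928 := by
  have hu' : groundEnergyAt (fermionTorusGraph 2 4) 1 12 16 ≤ ((-205889822849/34359738368 : ℚ) : ℝ) := by
    rw [groundEnergyAt_fermionTorusGraph_two]; push_cast; simpa [E₀] using hu
  have hH : hamiltonian (fermionTorusGraph 2 4) 1 12 *ᵥ ψ =
      ((groundEnergyAt (fermionTorusGraph 2 4) 1 12 16 : ℝ) : ℂ) • ψ := hψ.2.2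
  have h2 := up hu' ψ hψ.1 hψ1 hH
  rw [Matrix.smul_mulVec, dotProduct_smul] at h2
  push_cast at h2
  simp only [one_smul, neg_smul, Complex.neg_re] at h2
  unfold expect
  constructor <;> linarith

/-- `spinNN_4x4_U12_ceiling` (per-bond part) with the hypothesis taken as the claim node `torusUpper_mbbootE2_4x4_U12_N16`. Zero admits. -/
theorem spinNN_4x4_U12_ceiling_of_claim
    (up : sdp_corr_sector_hub_torus4x4_U12_N16_b4eom_Sup)
    (h : torusUpper_mbbootE2_4x4_U12_N16)
    {ψ : Fock (Orb (FermionTorus 2 4))} (hψ : IsGroundState (hamiltonian (fermionTorusGraph 2 4) 1 12) 16 ψ)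
    (hψ1 : star ψ ⬝ᵥ ψ = 1) :
    (expect (∑ x : FermionTorus 2 4, ∑ y : FermionTorus 2 4, if (fermionTorusGraph 2 4).Adj x y then fermionSpinDot x y else 0) ψ).re / 64 ≤ -0.2320928 :=
  (spinNN_4x4_U12_ceiling up
  (by have := groundEnergyAt_rect_4x4_U12_N16_le_of_claim h; unfold E₀; push_cast; linarith) hψ hψ1).2

end Gen128SectorCorrelatorsU2U6U12

end Summit.HubbardSuperconductivity.ManyBodyBootstrap.Bounds

end
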